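import Mathlib
import HarnessLib

/-!
# S2 brick F2 — the chart algebra of the conductor-𝟙 core: `σ`-degree calculus, invariants, monic identities

(crux stmt-ResolutionOfSingularities-15640 `WildQuotients.WildQuotientResolution`, line `Sketch`;
post-V5 rung S2 = `ConductorOneCore p n` (res-L1-w45c-lead-1 g5, `L/res-L1-w45c-lead-1/S2-DESIGN.md`
3e84e3bb6bc05e04 §1–§2 / §6 brick F2 «the chart model k[s,t][D̃⁻¹] with σ̃ by the laws; invariance of
T, b_j, b_j w_k, T w^α, b^β/T» and the monic identities (N3)). [OURS · L1 W4.5c] — NOT a statement of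
any manuscript; replaces the role of no printed item. LAW-BASED (any commutative ring `S` with an
endomorphism `σ` and elements `s, t_j` subject to the chart laws of S2-DESIGN §1; characteristic `p` only
where stated), def-free, inverses as explicit witnesses (`x * x' = 1`). Prover res-L1-w45c-stub-3.)

The chart laws (S2-DESIGN §1, unit-free): `σ s · (1 + s) = s`, `σ t_j · (1 + s t_j) = t_j (1 + s)`
with `1 + s t_j` units. The «`σ`-DEGREE» of `x` is `d` when `σ x · (1+s)^d = x`, and `−d` when
`σ x = x · (1+s)^d`; degrees add under products (`mul_deg`, `prod_deg`, `pow_deg`, `prod_negdeg`,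
`pow_negdeg`), and: `s` has degree `1` (`pow_s_deg`), `c_k = (1 − t_k)/t_k` degree `1` (`c_deg`),
`d_j = t_j/(1 − t_j)` degree `−1` (`d_negdeg`), `b_j = s·d_j` degree `0` (`b_invariant`), and — the one
characteristic-`p` input `(1+s)^p = 1 + s^p` — `1 − s^{p−1}` has degree `p` (`one_sub_pow_deg`). Hence
(`invariant_of_deg_p`, `invariant_of_negdeg_p`) with `v = (1 − s^{p−1})⁻¹`:
`T = s^p v` (`T_invariant`), `T w^α = s^{p−|α|} c^α v` for `|α| ≤ p` (`Tw_invariant`), `b^β/T = d^β (1 − s^{p−1})`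
for `|β| = p` (`bβT_invariant`) are `σ`-INVARIANT — the generators of the monomial model (CLAIM P).
Monic identities (N3) (pure algebra; `ν`-closed forms use characteristic `p`): `s^p + T s^{p−1} − T = 0`
(`monic_s`); `(b_j^p/T)(1 − t_j)^p + b_j^{p−1}(1 − t_j)^{p−1} t_j − t_j^p = 0` (`monic_one_sub_t`) with
`ν_j := 1 − b_j^{p−1} + b_j^p/T = (1 − (s t_j)^{p−1})/(1 − t_j)^p` (`nu_J_mul`, so `ν_j` is a unit where `1 − t_j`
and the `D̃`-factor `1 − (s t_j)^{p−1}` are; `ν_j = 1/N(1 − t_j)`), `σ ν_j = ν_j` (`nu_J_invariant`);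
`(1 − t_k)^p + T w_k (1 − t_k)^{p−1} t_k − T w_k^p t_k^p = 0` (`monic_t`) with
`ν_k := 1 − T w_k + T w_k^p`, `ν_k · t_k^p (1 − s^{p−1}) = 1 − (s t_k)^{p−1}` (`nu_K_mul`), `σ ν_k = ν_k`
(`nu_K_invariant`).
-/

-- single-problem summit: the doubled namespace component `ResolutionOfSingularities` is forced
set_option linter.dupNamespace false

noncomputable section

namespace Summit.ResolutionOfSingularities.ResolutionOfSingularities.Theorems.WildQuotientResolution.ConductorOne

variable {S : Type} [CommRing S] (σ : S →+* S) (s : S) (hs : σ s * (1 + s) = s)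

/-! ## The degree calculus -/

/-- Degrees add: `deg x = a`, `deg y = b` ⇒ `deg (xy) = a + b`. [folklore] -/
theorem mul_deg {x y : S} {a b : ℕ} (hx : σ x * (1 + s) ^ a = x) (hy : σ y * (1 + s) ^ b = y) :
    σ (x * y) * (1 + s) ^ (a + b) = x * y := by
  rw [map_mul, pow_add, ← hx, ← hy]; ring_nf
  rw [hx, hy]

/-- Degrees add over finite products. [folklore] -/
theorem prod_deg {κ : Type} (K : Finset κ) (f : κ → S) (e : κ → ℕ)
    (h : ∀ k ∈ K, σ (f k) * (1 + s) ^ (e k) = f k) :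
    σ (∏ k ∈ K, f k) * (1 + s) ^ (∑ k ∈ K, e k) = ∏ k ∈ K, f k := by
  classical
  induction K using Finset.induction_on with
  | empty => simp
  | insert a K ha ih =>
    rw [Finset.prod_insert ha, Finset.sum_insert ha]
    exact mul_deg σ s (h a (Finset.mem_insert_self a K))
      (ih fun k hk => h k (Finset.mem_insert_of_mem hk))

/-- Powers: `deg x = a` ⇒ `deg (x^m) = m a`. [folklore] -/
theorem pow_deg {x : S} {a : ℕ} (hx : σ x * (1 + s) ^ a = x) (m : ℕ) :
    σ (x ^ m) * (1 + s) ^ (m * a) = x ^ m := by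
  rw [map_pow, mul_comm m a, pow_mul, ← mul_pow, hx]

/-- Negative degrees add over finite products: `σ (f j) = f j · (1+s)^(e j)` for all `j ∈ J` ⇒
`σ (∏ f) = (∏ f) · (1+s)^(∑ e)`. [folklore] -/
theorem prod_negdeg {κ : Type} (J : Finset κ) (f : κ → S) (e : κ → ℕ)
    (h : ∀ j ∈ J, σ (f j) = f j * (1 + s) ^ (e j)) :
    σ (∏ j ∈ J, f j) = (∏ j ∈ J, f j) * (1 + s) ^ (∑ j ∈ J, e j) := by
  classical
  induction J using Finset.induction_on with
  | empty => simp
  | insert a J ha ih =>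
    rw [Finset.prod_insert ha, Finset.sum_insert ha, map_mul, h a (Finset.mem_insert_self a J),
      ih fun k hk => h k (Finset.mem_insert_of_mem hk), pow_add]
    ring

/-- Negative degrees of powers: `σ x = x (1+s)^a` ⇒ `σ (x^m) = x^m (1+s)^(m a)`. [folklore] -/
theorem pow_negdeg {x : S} {a : ℕ} (hx : σ x = x * (1 + s) ^ a) (m : ℕ) :
    σ (x ^ m) = x ^ m * (1 + s) ^ (m * a) := by
  rw [map_pow, hx, mul_pow, ← pow_mul, mul_comm a m]

include hs in
/-- `deg s^m = m`. [folklore] -/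
theorem pow_s_deg (m : ℕ) : σ (s ^ m) * (1 + s) ^ m = s ^ m := by
  rw [map_pow, ← mul_pow, hs]

/-- A degree-`0` element is invariant (bookkeeping form). [folklore] -/
theorem invariant_of_deg_zero {x : S} (hx : σ x * (1 + s) ^ 0 = x) : σ x = x := by
  rwa [pow_zero, mul_one] at hx

/-! ## The chart elements `1 − t_j`, `c_k = (1 − t_k)/t_k`, `d_j = t_j/(1 − t_j)`, `b_j = s d_j` -/

variable {ι : Type} (t : ι → S) (ht : ∀ j, σ (t j) * (1 + s * t j) = t j * (1 + s))

include ht in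
/-- `σ (1 − t_j) · (1 + s t_j) = 1 − t_j` (S2-DESIGN §1). [folklore] -/
theorem one_sub_t_law (j : ι) : σ (1 - t j) * (1 + s * t j) = 1 - t j := by
  have h := ht j
  rw [map_sub, map_one]
  linear_combination (-1 : S) * h

include ht in
/-- `c_k = (1 − t_k)/t_k` has degree `1`, unit-free form: `σ(1 − t_k) · t_k · (1 + s) = σ(t_k) · (1 − t_k)`
(cancel the unit `1 + s t_k`). [folklore] -/
theorem c_deg_law (h1st : ∀ j, IsUnit (1 + s * t j)) (k : ι) :
    σ (1 - t k) * t k * (1 + s) = σ (t k) * (1 - t k) := by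
  apply (h1st k).mul_left_injective
  change σ (1 - t k) * t k * (1 + s) * (1 + s * t k) = σ (t k) * (1 - t k) * (1 + s * t k)
  have h1 := ht k
  have h2 := one_sub_t_law σ s t ht k
  linear_combination (t k * (1 + s)) * h2 - (1 - t k) * h1

include ht in
/-- `c_k = (1 − t_k)·t_k⁻¹` (for `t_k` invertible, inverse witness `tk'`) has degree `1`. [folklore] -/
theorem c_deg (h1st : ∀ j, IsUnit (1 + s * t j)) (k : ι) (tk' : S) (htk : t k * tk' = 1) :
    σ ((1 - t k) * tk') * (1 + s) ^ 1 = (1 - t k) * tk' := by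
  have e2 : σ tk' * σ (t k) = 1 := by rw [← map_mul, mul_comm, htk, map_one]
  have key := c_deg_law σ s t ht h1st k
  rw [pow_one, map_mul]
  linear_combination (-(σ (1 - t k) * σ tk' * (1 + s))) * htk
    + (σ tk' * tk') * key + ((1 - t k) * tk') * e2

include ht in
/-- `d_j = t_j/(1 − t_j)` has degree `−1`, unit-free form: `σ(t_j) · (1 − t_j) = t_j (1 + s) · σ(1 − t_j)`.
[folklore] -/
theorem d_negdeg_law (h1st : ∀ j, IsUnit (1 + s * t j)) (j : ι) :
    σ (t j) * (1 - t j) = t j * (1 + s) * σ (1 - t j) := by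
  apply (h1st j).mul_left_injective
  change σ (t j) * (1 - t j) * (1 + s * t j) = t j * (1 + s) * σ (1 - t j) * (1 + s * t j)
  have h1 := ht j
  have h2 := one_sub_t_law σ s t ht j
  linear_combination (1 - t j) * h1 - (t j * (1 + s)) * h2

include ht in
/-- `d_j = t_j·(1 − t_j)⁻¹` (inverse witness `oj'` of `1 − t_j`) has degree `−1`: `σ d_j = d_j · (1 + s)`.
[folklore] -/
theorem d_negdeg (h1st : ∀ j, IsUnit (1 + s * t j)) (j : ι) (oj' : S) (hoj : (1 - t j) * oj' = 1) :
    σ (t j * oj') = t j * oj' * (1 + s) := by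
  have e2 : σ oj' * σ (1 - t j) = 1 := by rw [← map_mul, mul_comm, hoj, map_one]
  have key := d_negdeg_law σ s t ht h1st j
  rw [map_mul]
  linear_combination (-(σ (t j) * σ oj')) * hoj + (σ oj' * oj') * key + (t j * oj' * (1 + s)) * e2

include hs ht in
/-- **`b_j = s t_j/(1 − t_j)` is `σ`-invariant** (degree `1 + (−1) = 0`; S2-DESIGN §2). [OURS · L1 W4.5c] -/
theorem b_invariant (h1st : ∀ j, IsUnit (1 + s * t j)) (j : ι) (oj' : S) (hoj : (1 - t j) * oj' = 1) :
    σ (s * (t j * oj')) = s * (t j * oj') := by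
  rw [map_mul, d_negdeg σ s t ht h1st j oj' hoj]
  calc σ s * (t j * oj' * (1 + s)) = σ s * (1 + s) * (t j * oj') := by ring
    _ = s * (t j * oj') := by rw [hs]

/-! ## Characteristic `p`: `1 − s^{p−1}` has degree `p`; the invariants `T`, `T w^α`, `b^β/T` -/

include hs in
/-- **`1 − s^{p−1}` has degree `p`** in characteristic `p`: `σ(1 − s^{p−1}) · (1+s)^p = 1 − s^{p−1}`
(`(1+s)^p = 1 + s^p`). [OURS · L1 W4.5c] -/
theorem one_sub_pow_deg (p : ℕ) [hp : Fact p.Prime] [CharP S p] :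
    σ (1 - s ^ (p - 1)) * (1 + s) ^ p = 1 - s ^ (p - 1) := by
  have hp0 : p ≠ 0 := hp.out.ne_zero
  have hfrob : (1 + s) ^ p = 1 + s ^ p := by rw [add_pow_char, one_pow]
  have h1 := pow_s_deg σ s hs (p - 1)
  have h2 : σ (s ^ (p - 1)) * (1 + s) ^ p = s ^ (p - 1) * (1 + s) := by
    rw [← pow_sub_one_mul hp0 (1 + s), ← mul_assoc, h1]
  rw [map_sub, map_one, sub_mul, one_mul, h2, hfrob, mul_add, mul_one, pow_sub_one_mul hp0 s]
  ring

include hs in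
/-- **Degree-`p` elements divided by `1 − s^{p−1}` are invariant**: if `σ M · (1+s)^p = M` and
`(1 − s^{p−1}) v = 1`, then `σ (M v) = M v`. [OURS · L1 W4.5c] -/
theorem invariant_of_deg_p (p : ℕ) [Fact p.Prime] [CharP S p] (v : S) (hv : (1 - s ^ (p - 1)) * v = 1)
    {M : S} (hM : σ M * (1 + s) ^ p = M) : σ (M * v) = M * v := by
  have hinv : σ v * σ (1 - s ^ (p - 1)) = 1 := by rw [← map_mul, mul_comm, hv, map_one]
  have hdeg := one_sub_pow_deg σ s hs p
  -- cancel the unit `1 − s^{p−1} = σ(1 − s^{p−1}) · (1+s)^p`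
  apply (IsUnit.of_mul_eq_one _ hv).mul_left_injective
  change σ (M * v) * (1 - s ^ (p - 1)) = M * v * (1 - s ^ (p - 1))
  rw [mul_assoc M, mul_comm v, hv, mul_one, map_mul]
  calc σ M * σ v * (1 - s ^ (p - 1))
      = σ M * σ v * (σ (1 - s ^ (p - 1)) * (1 + s) ^ p) := by rw [hdeg]
    _ = σ M * (1 + s) ^ p * (σ v * σ (1 - s ^ (p - 1))) := by ring
    _ = M := by rw [hinv, mul_one, hM]

include hs in
/-- **Degree-`−p` elements times `1 − s^{p−1}` are invariant**: if `σ N = N · (1+s)^p` then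
`σ (N · (1 − s^{p−1})) = N · (1 − s^{p−1})`. [OURS · L1 W4.5c] -/
theorem invariant_of_negdeg_p (p : ℕ) [Fact p.Prime] [CharP S p] {N : S}
    (hN : σ N = N * (1 + s) ^ p) : σ (N * (1 - s ^ (p - 1))) = N * (1 - s ^ (p - 1)) := by
  rw [map_mul, hN, mul_assoc, mul_comm ((1 + s) ^ p), one_sub_pow_deg σ s hs p]

include hs in
/-- **`T = s^p/(1 − s^{p−1})` is `σ`-invariant** (`T = N(uᵢ)`, S2-DESIGN §2). [OURS · L1 W4.5c] -/
theorem T_invariant (p : ℕ) [Fact p.Prime] [CharP S p] (v : S) (hv : (1 - s ^ (p - 1)) * v = 1) :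
    σ (s ^ p * v) = s ^ p * v :=
  invariant_of_deg_p σ s hs p v hv (pow_s_deg σ s hs p)

include hs ht in
/-- **`T w^α = s^{p−|α|} · ∏_{k∈K} c_k^{α_k} · (1 − s^{p−1})⁻¹` is `σ`-invariant for `|α| ≤ p`**
(`c_k = (1 − t_k) t_k⁻¹`, inverse witnesses `tinv`; S2-DESIGN §2). [OURS · L1 W4.5c] -/
theorem Tw_invariant (p : ℕ) [Fact p.Prime] [CharP S p] (v : S) (hv : (1 - s ^ (p - 1)) * v = 1)
    (h1st : ∀ j, IsUnit (1 + s * t j)) {κ : Type} (K : Finset κ) (e : κ → ι) (tinv : κ → S)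
    (htinv : ∀ k ∈ K, t (e k) * tinv k = 1) (α : κ → ℕ) (hα : ∑ k ∈ K, α k ≤ p) :
    σ (s ^ (p - ∑ k ∈ K, α k) * (∏ k ∈ K, ((1 - t (e k)) * tinv k) ^ (α k)) * v)
      = s ^ (p - ∑ k ∈ K, α k) * (∏ k ∈ K, ((1 - t (e k)) * tinv k) ^ (α k)) * v := by
  apply invariant_of_deg_p σ s hs p v hv
  have hprod : σ (∏ k ∈ K, ((1 - t (e k)) * tinv k) ^ (α k)) * (1 + s) ^ (∑ k ∈ K, α k * 1)
      = ∏ k ∈ K, ((1 - t (e k)) * tinv k) ^ (α k) :=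
    prod_deg σ s K (fun k => ((1 - t (e k)) * tinv k) ^ (α k)) (fun k => α k * 1)
      fun k hk => pow_deg σ s (c_deg σ s t ht h1st (e k) (tinv k) (htinv k hk)) (α k)
  simp only [mul_one] at hprod
  have := mul_deg σ s (pow_s_deg σ s hs (p - ∑ k ∈ K, α k)) hprod
  rwa [Nat.sub_add_cancel hα] at this

include hs ht in
/-- **`b^β/T = ∏_{j∈J} d_j^{β_j} · (1 − s^{p−1})` is `σ`-invariant for `|β| = p`**
(`d_j = t_j (1 − t_j)⁻¹`, inverse witnesses `oinv`; S2-DESIGN §2). [OURS · L1 W4.5c] -/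
theorem bβT_invariant (p : ℕ) [Fact p.Prime] [CharP S p] (h1st : ∀ j, IsUnit (1 + s * t j))
    {κ : Type} (J : Finset κ) (e : κ → ι) (oinv : κ → S)
    (hoinv : ∀ j ∈ J, (1 - t (e j)) * oinv j = 1) (β : κ → ℕ) (hβ : ∑ j ∈ J, β j = p) :
    σ ((∏ j ∈ J, (t (e j) * oinv j) ^ (β j)) * (1 - s ^ (p - 1)))
      = (∏ j ∈ J, (t (e j) * oinv j) ^ (β j)) * (1 - s ^ (p - 1)) := by
  apply invariant_of_negdeg_p σ s hs p
  have hprod := prod_negdeg σ s J (fun j => (t (e j) * oinv j) ^ (β j)) (fun j => β j * 1)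
    fun j hj => pow_negdeg σ s (a := 1)
      (by rw [pow_one]; exact d_negdeg σ s t ht h1st (e j) (oinv j) (hoinv j hj)) (β j)
  simp only [mul_one] at hprod
  rwa [hβ] at hprod

/-! ## The monic identities (N3) and the units `ν_j`, `ν_k` -/

/-- **(N3, the `s`-equation)** `s^p + T s^{p−1} − T = 0` for `T = s^p v`, `(1 − s^{p−1}) v = 1`. [OURS · L1 W4.5c] -/
theorem monic_s (p : ℕ) [hp : Fact p.Prime] (v : S) (hv : (1 - s ^ (p - 1)) * v = 1) :
    s ^ p + s ^ p * v * s ^ (p - 1) - s ^ p * v = 0 := by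
  have hp0 : p ≠ 0 := hp.out.ne_zero
  have hsp : s ^ (p - 1) * s = s ^ p := pow_sub_one_mul hp0 s
  linear_combination (-(s ^ p)) * hv

/-- **(N3, the `(1 − t_j)`-equation, `j ∈ J`)** with `d_j = t_j oj'` (`(1 − t_j) oj' = 1`), `b_j = s d_j`,
`b_j^p/T = d_j^p (1 − s^{p−1})`:  `(b_j^p/T)(1 − t_j)^p + b_j^{p−1}(1 − t_j)^{p−1} t_j − t_j^p = 0`
(pure algebra, any characteristic). [OURS · L1 W4.5c] -/
theorem monic_one_sub_t (p : ℕ) [hp : Fact p.Prime] (j : ι) (oj' : S) (hoj : (1 - t j) * oj' = 1) :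
    (t j * oj') ^ p * (1 - s ^ (p - 1)) * (1 - t j) ^ p
      + (s * (t j * oj')) ^ (p - 1) * (1 - t j) ^ (p - 1) * t j - t j ^ p = 0 := by
  have hp0 : p ≠ 0 := hp.out.ne_zero
  have hd : t j * oj' * (1 - t j) = t j := by linear_combination (t j) * hoj
  have e1 : (t j * oj') ^ p * (1 - t j) ^ p = t j ^ p := by rw [← mul_pow, hd]
  have e2 : (s * (t j * oj')) ^ (p - 1) * (1 - t j) ^ (p - 1) = s ^ (p - 1) * t j ^ (p - 1) := by
    rw [← mul_pow, mul_assoc, hd, mul_pow]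
  have e3 : t j ^ (p - 1) * t j = t j ^ p := pow_sub_one_mul hp0 (t j)
  calc (t j * oj') ^ p * (1 - s ^ (p - 1)) * (1 - t j) ^ p
        + (s * (t j * oj')) ^ (p - 1) * (1 - t j) ^ (p - 1) * t j - t j ^ p
      = (t j * oj') ^ p * (1 - t j) ^ p * (1 - s ^ (p - 1))
        + (s * (t j * oj')) ^ (p - 1) * (1 - t j) ^ (p - 1) * t j - t j ^ p := by ring
    _ = 0 := by rw [e1, e2, mul_assoc, e3]; ring

/-- **The unit `ν_j` in closed form** (characteristic `p`): `ν_j := 1 − b_j^{p−1} + b_j^p/T` satisfies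
`ν_j · (1 − t_j)^p = 1 − (s t_j)^{p−1}` — so `ν_j` is a unit wherever `1 − t_j` and the `D̃`-factor
`1 − (s t_j)^{p−1}` are (and `ν_j = 1/N(1 − t_j)`). [OURS · L1 W4.5c] -/
theorem nu_J_mul (p : ℕ) [hp : Fact p.Prime] [CharP S p] (j : ι) (oj' : S) (hoj : (1 - t j) * oj' = 1) :
    (1 - (s * (t j * oj')) ^ (p - 1) + (t j * oj') ^ p * (1 - s ^ (p - 1))) * (1 - t j) ^ p
      = 1 - (s * t j) ^ (p - 1) := by
  have hp0 : p ≠ 0 := hp.out.ne_zero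
  have hd : t j * oj' * (1 - t j) = t j := by linear_combination (t j) * hoj
  have e1 : (t j * oj') ^ p * (1 - t j) ^ p = t j ^ p := by rw [← mul_pow, hd]
  have e2 : (s * (t j * oj')) ^ (p - 1) * (1 - t j) ^ (p - 1) = (s * t j) ^ (p - 1) := by
    rw [← mul_pow, mul_assoc, hd]
  have e4 : (1 - t j) ^ (p - 1) * (1 - t j) = (1 - t j) ^ p := pow_sub_one_mul hp0 _
  have hfrob : (1 - t j) ^ p = 1 - t j ^ p := by rw [sub_pow_char, one_pow]
  calc (1 - (s * (t j * oj')) ^ (p - 1) + (t j * oj') ^ p * (1 - s ^ (p - 1))) * (1 - t j) ^ p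
      = (1 - t j) ^ p - (s * (t j * oj')) ^ (p - 1) * ((1 - t j) ^ (p - 1) * (1 - t j))
          + (t j * oj') ^ p * (1 - t j) ^ p * (1 - s ^ (p - 1)) := by rw [e4]; ring
    _ = (1 - t j) ^ p - (s * t j) ^ (p - 1) * (1 - t j) + t j ^ p * (1 - s ^ (p - 1)) := by
          rw [← mul_assoc, e2, e1]
    _ = 1 - (s * t j) ^ (p - 1) := by
          rw [hfrob, mul_pow]
          have e5 : t j ^ (p - 1) * t j = t j ^ p := pow_sub_one_mul hp0 _
          linear_combination (s ^ (p - 1)) * e5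

include hs ht in
/-- **`ν_j` is `σ`-invariant** (`b_j` and `b_j^p/T` are). [OURS · L1 W4.5c] -/
theorem nu_J_invariant (p : ℕ) [Fact p.Prime] [CharP S p] (h1st : ∀ j, IsUnit (1 + s * t j)) (j : ι)
    (oj' : S) (hoj : (1 - t j) * oj' = 1) :
    σ (1 - (s * (t j * oj')) ^ (p - 1) + (t j * oj') ^ p * (1 - s ^ (p - 1)))
      = 1 - (s * (t j * oj')) ^ (p - 1) + (t j * oj') ^ p * (1 - s ^ (p - 1)) := by
  have hb := b_invariant σ s hs t ht h1st j oj' hoj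
  have hB := bβT_invariant σ s hs t ht p h1st ({()} : Finset Unit) (fun _ => j) (fun _ => oj')
    (fun _ _ => hoj) (fun _ => p) (by simp)
  simp only [Finset.prod_singleton] at hB
  rw [map_add, map_sub, map_one, map_pow, hb, hB]

/-- **(N3, the `t_k`-equation, `k ∈ K`)** with `c_k = (1 − t_k) tk'` (`t_k tk' = 1`), `T w_k = s^{p−1} c_k v`,
`T w_k^p = c_k^p v` (`(1 − s^{p−1}) v = 1`):  `(1 − t_k)^p + T w_k (1 − t_k)^{p−1} t_k − T w_k^p t_k^p = 0`
(pure algebra, any characteristic). [OURS · L1 W4.5c] -/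
theorem monic_t (p : ℕ) [hp : Fact p.Prime] (v : S) (hv : (1 - s ^ (p - 1)) * v = 1) (k : ι) (tk' : S)
    (htk : t k * tk' = 1) :
    (1 - t k) ^ p + s ^ (p - 1) * ((1 - t k) * tk') * v * (1 - t k) ^ (p - 1) * t k
      - ((1 - t k) * tk') ^ p * v * t k ^ p = 0 := by
  have hp0 : p ≠ 0 := hp.out.ne_zero
  have hc : (1 - t k) * tk' * t k = 1 - t k := by linear_combination (1 - t k) * htk
  have e1 : ((1 - t k) * tk') ^ p * t k ^ p = (1 - t k) ^ p := by rw [← mul_pow, hc]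
  have e4 : (1 - t k) ^ (p - 1) * (1 - t k) = (1 - t k) ^ p := pow_sub_one_mul hp0 _
  calc (1 - t k) ^ p + s ^ (p - 1) * ((1 - t k) * tk') * v * (1 - t k) ^ (p - 1) * t k
        - ((1 - t k) * tk') ^ p * v * t k ^ p
      = (1 - t k) ^ p + s ^ (p - 1) * v * ((1 - t k) ^ (p - 1) * ((1 - t k) * tk' * t k))
        - ((1 - t k) * tk') ^ p * t k ^ p * v := by ring
    _ = (1 - t k) ^ p * (1 - (1 - s ^ (p - 1)) * v) := by rw [hc, e4, e1]; ring
    _ = 0 := by rw [hv]; ring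

/-- **The unit `ν_k` in closed form** (characteristic `p`): `ν_k := 1 − T w_k + T w_k^p` satisfies
`ν_k · t_k^p · (1 − s^{p−1}) = 1 − (s t_k)^{p−1}` — so `ν_k` is a unit wherever `t_k` and the
`D̃`-factors are. [OURS · L1 W4.5c] -/
theorem nu_K_mul (p : ℕ) [hp : Fact p.Prime] [CharP S p] (v : S) (hv : (1 - s ^ (p - 1)) * v = 1)
    (k : ι) (tk' : S) (htk : t k * tk' = 1) :
    (1 - s ^ (p - 1) * ((1 - t k) * tk') * v + ((1 - t k) * tk') ^ p * v) * t k ^ p * (1 - s ^ (p - 1))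
      = 1 - (s * t k) ^ (p - 1) := by
  have hp0 : p ≠ 0 := hp.out.ne_zero
  have hc : (1 - t k) * tk' * t k = 1 - t k := by linear_combination (1 - t k) * htk
  have e1 : ((1 - t k) * tk') ^ p * t k ^ p = (1 - t k) ^ p := by rw [← mul_pow, hc]
  have e3 : t k ^ (p - 1) * t k = t k ^ p := pow_sub_one_mul hp0 _
  have hfrob : (1 - t k) ^ p = 1 - t k ^ p := by rw [sub_pow_char, one_pow]
  calc (1 - s ^ (p - 1) * ((1 - t k) * tk') * v + ((1 - t k) * tk') ^ p * v) * t k ^ p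
        * (1 - s ^ (p - 1))
      = (t k ^ p - s ^ (p - 1) * (t k ^ (p - 1) * ((1 - t k) * tk' * t k))
          + ((1 - t k) * tk') ^ p * t k ^ p) * ((1 - s ^ (p - 1)) * v)
        + t k ^ p * (1 - (1 - s ^ (p - 1)) * v) - t k ^ p * s ^ (p - 1) := by rw [← e3]; ring
    _ = 1 - (s * t k) ^ (p - 1) := by
          rw [hc, e1, hv, hfrob, mul_pow]
          linear_combination (s ^ (p - 1)) * e3

include hs ht in
/-- **`ν_k` is `σ`-invariant** (`T w_k` and `T w_k^p` are, degrees `(p−1)+1` and `p`). [OURS · L1 W4.5c] -/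
theorem nu_K_invariant (p : ℕ) [hp : Fact p.Prime] [CharP S p] (v : S) (hv : (1 - s ^ (p - 1)) * v = 1)
    (h1st : ∀ j, IsUnit (1 + s * t j)) (k : ι) (tk' : S) (htk : t k * tk' = 1) :
    σ (1 - s ^ (p - 1) * ((1 - t k) * tk') * v + ((1 - t k) * tk') ^ p * v)
      = 1 - s ^ (p - 1) * ((1 - t k) * tk') * v + ((1 - t k) * tk') ^ p * v := by
  have h1p : 1 ≤ p := hp.out.one_le
  -- `T w_k`: α = 1 on the singleton
  have hA := Tw_invariant σ s hs t ht p v hv h1st ({()} : Finset Unit) (fun _ => k) (fun _ => tk')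
    (fun _ _ => htk) (fun _ => 1) (by simpa using h1p)
  -- `T w_k^p`: α = p on the singleton
  have hC := Tw_invariant σ s hs t ht p v hv h1st ({()} : Finset Unit) (fun _ => k) (fun _ => tk')
    (fun _ _ => htk) (fun _ => p) (by simp)
  simp only [Finset.sum_singleton, Finset.prod_singleton, pow_one, Nat.sub_self, pow_zero,
    one_mul] at hA hC
  rw [map_add, map_sub, map_one, hA, hC]

end Summit.ResolutionOfSingularities.ResolutionOfSingularities.Theorems.WildQuotientResolution.ConductorOne

end
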